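import Summits.BirchSwinnertonDyer.BirchSwinnertonDyer.Theorems.PrintCf2SplitBadTwoNormAtVbarTotallyRamified
import HarnessLib

/-!
# Crux `PrintCf2.SplitBadTwoRankOneOfFacts` (stmt-BirchSwinnertonDyer-20368), skeleton v13.5, (REG₂) `stub_xRegular_two` FACT-FREE road, R2 brick
# **B5-T, case (B2) ⟹ (B1) WITHOUT CYCLICITY: extending `ε|_{D}` across `Γ_K = D · U` to a sign `χ` trivial on `U`**

Cell `bsd-print-cf2`, EXTRA WIDTH seat `bsd-line-cf2-p1-w4` g14 (prover-bsd-line-cf2-p1-w4-g14-0); `--supports stmt-BirchSwinnertonDyer-20368`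
(helper, Theses-free). HONEST FRAMING: nothing here closes the crux or a registered stub; BSD is not proved by any of this; no summit
statement is proved by this seat. No definition, no named fact, no `sorry`. Pure group theory + one line of topology.

WHY (STATUS 2026-08-29T07:56:35Z «B5-T ADDENDUM», 09:1xZ). The twisted `v̄`-reading (p709686 / p710167 / the assembled
`dvd_log_valuation_of_dualShapiro_mem_twisted`) is proved in case (B1): the sign `ε` of the quadratic `θ₀` is `1` on the decomposition group
`D_v̄`. When `ε = 1` only on `U ∩ D_v̄` (`U = Gal(K̄/K^{(v̄)}_n)`) — case (B2) — one re-twists the coefficients by a sign `χ` with `χ|_U = 1` and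
`χ|_{D_v̄} = ε|_{D_v̄}` (then `εχ` is in case (B1), and (LSₙ) is insensitive to the re-twist: p708344 `SignTwist.locSurj_of_signEquiv`). On the
frame `Γ_K = I_𝔓₀ · U ⊆ D_v̄ · U`, so such a `χ` exists by PURE GROUP THEORY — no cyclicity of `Gal(K^{(v̄)}_n/K)`, no explicit `χ_{κ₂}`:
* **`exists_signHom_eq_on_of_mul_eq_top`** — `G` a group, `D, U ≤ G` with `U` normal and `G = D · U` (`∀ g, ∃ d ∈ D, d⁻¹ g ∈ U`), `ε : G →* ℤˣ`
  with `ε = 1` on `D ∩ U` ⟹ `∃ χ : G →* ℤˣ`, `χ|_U = 1` and `χ|_D = ε|_D` (`χ(d u) := ε(d)`, well defined and multiplicative because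
  `d_{gh}⁻¹ d_g d_h ∈ D ∩ U`);
* `isOpen_ker_of_le` — a sign whose kernel contains an open subgroup has open kernel; `isOpen_ker_mul` — so has a product of two such signs
  (the `hε` input of `NormAtVbar.exists_signTwistZMod` / `LayerShapiro.locSurj_layers_twisted` for `εχ`);
* **`exists_signHom_retwist`** — ON THE FRAME (`Γ_K = I_𝔓₀ · Gal(K̄/F)`, -w3 g14 `forall_exists_inertia_mul_mem_galFixing_layer`): if `ε = 1` on
  `Gal(K̄/F) ∩ D_v̄` then there is `χ : Γ_K →* ℤˣ` with `χ = 1` on `Gal(K̄/F)`, open kernel, `ker (εχ)` open and **`εχ = 1` on `D_v̄`** — i.e.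
  the re-twisted sign `εχ` is in case (B1) of `NormAtVbar.dvd_log_valuation_of_dualShapiro_mem_twisted`, while `χ|_U = 1` makes (LSₙ) for the
  `εχ`-twisted coefficients equivalent to (LSₙ) for the `ε`-twisted ones (p708344).
presearch: extension of a character across a product decomposition `G = DU` — elementary; no source needed, no new fact. beyond-print theorem: no.

References: [SerreLocalFields1979] VII §5 (restriction/corestriction bookkeeping); [GreenbergLNM1716] §4 p. 107 (twists by characters of the layer group).
-/

set_option linter.dupNamespace false
set_option autoImplicit false

namespace Summit.BirchSwinnertonDyer.BirchSwinnertonDyer.Theorems.PrintCf2.SignTwist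

/-! ## §1. Extending `ε|_D` across `G = D · U` -/

section Extension

variable {G : Type*} [Group G] (D U : Subgroup G) [U.Normal] (ε : G →* ℤˣ)

/-- **Extension of a sign across `G = D · U`.** If `U ⊴ G`, every `g ∈ G` is `d u` with `d ∈ D`, `u ∈ U`, and the sign `ε : G →* ℤˣ` is
trivial on `D ∩ U`, then there is a sign `χ : G →* ℤˣ` with `χ|_U = 1` and `χ|_D = ε|_D` (namely `χ(d u) = ε(d)`). [folklore] -/
theorem exists_signHom_eq_on_of_mul_eq_top (hDU : ∀ g : G, ∃ d ∈ D, d⁻¹ * g ∈ U) (hε : ∀ u ∈ U, u ∈ D → ε u = 1) :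
    ∃ χ : G →* ℤˣ, (∀ u ∈ U, χ u = 1) ∧ ∀ d ∈ D, χ d = ε d := by
  classical
  choose d hdD hdU using hDU
  -- the value `ε (d g)` does not depend on the choice of the `D`-component
  have hwd : ∀ (g : G) (d' : G), d' ∈ D → d'⁻¹ * g ∈ U → ε (d g) = ε d' := by
    intro g d' hd'D hd'U
    -- `d'⁻¹ d_g = (d'⁻¹ g) (d_g⁻¹ g)⁻¹ ∈ U ∩ D`
    have hmemU : d'⁻¹ * d g ∈ U := by
      have h' : d'⁻¹ * d g = (d'⁻¹ * g) * ((d g)⁻¹ * g)⁻¹ := by group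
      rw [h']
      exact U.mul_mem hd'U (U.inv_mem (hdU g))
    have hmemD : d'⁻¹ * d g ∈ D := D.mul_mem (D.inv_mem hd'D) (hdD g)
    have h1 := hε _ hmemU hmemD
    rw [map_mul, map_inv, inv_mul_eq_one] at h1
    exact h1.symm
  refine ⟨{ toFun := fun g ↦ ε (d g)
            map_one' := ?_
            map_mul' := fun g h ↦ ?_ }, fun u hu ↦ ?_, fun d' hd' ↦ ?_⟩
  · -- `d_1 ∈ D ∩ U`
    exact hwd 1 1 D.one_mem (by rw [inv_one, one_mul]; exact U.one_mem) |>.trans (map_one ε)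
  · -- `d_{gh}` versus `d_g d_h`: `(d_g d_h)⁻¹ (g h) = d_h⁻¹ (d_g⁻¹ g) d_h · (d_h⁻¹ h) ∈ U`
    have hprod : (d g * d h)⁻¹ * (g * h) ∈ U := by
      have e1 : (d g * d h)⁻¹ * (g * h) = ((d h)⁻¹ * ((d g)⁻¹ * g) * (d h)⁻¹⁻¹) * ((d h)⁻¹ * h) := by group
      rw [e1]
      exact U.mul_mem (Subgroup.Normal.conj_mem inferInstance _ (hdU g) (d h)⁻¹) (hdU h)
    change ε (d (g * h)) = ε (d g) * ε (d h)
    rw [← map_mul]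
    exact hwd (g * h) (d g * d h) (D.mul_mem (hdD g) (hdD h)) hprod
  · -- `u ∈ U`: the `D`-component may be taken to be `1`
    change ε (d u) = 1
    rw [hwd u 1 D.one_mem (by rw [inv_one, one_mul]; exact hu), map_one]
  · change ε (d d') = ε d'
    exact hwd d' d' hd' (by rw [inv_mul_cancel]; exact U.one_mem)

end Extension

/-! ## §2. Open kernels -/

section Open

variable {G : Type*} [Group G] [TopologicalSpace G] [IsTopologicalGroup G]

/-- A sign whose kernel contains an open subgroup has open kernel. [folklore] -/
theorem isOpen_ker_of_le (χ : G →* ℤˣ) (U : Subgroup G) (hU : IsOpen (U : Set G)) (hle : U ≤ χ.ker) :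
    IsOpen ((χ.ker : Subgroup G) : Set G) :=
  Subgroup.isOpen_mono hle hU

/-- The product of two signs with open kernels has open kernel (it contains the open subgroup `ker ε ∩ ker χ`). [folklore] -/
theorem isOpen_ker_mul (ε χ : G →* ℤˣ) (hε : IsOpen ((ε.ker : Subgroup G) : Set G)) (hχ : IsOpen ((χ.ker : Subgroup G) : Set G)) :
    IsOpen (((ε * χ).ker : Subgroup G) : Set G) := by
  refine Subgroup.isOpen_mono (H₁ := ε.ker ⊓ χ.ker) ?_ (hε.inter hχ)
  intro g hg
  rw [Subgroup.mem_inf, MonoidHom.mem_ker, MonoidHom.mem_ker] at hg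
  rw [MonoidHom.mem_ker, MonoidHom.mul_apply, hg.1, hg.2, one_mul]

end Open

/-! ## §3. On the frame: the re-twisting sign -/

section Frame

open NumberField IsDedekindDomain Field
open Literature.NumberTheory.EllipticCurves Literature.NumberTheory.GaloisRepresentations
open Literature.NumberTheory.GaloisRepresentations.LocalWeilDatum

variable {K : Type} [Field K] [NumberField K]

/-- **The re-twisting sign (case (B2) ⟹ (B1)).** `F ⊆ K̄` with `U = Gal(K̄/F)` open and normal, `v̄` a finite place with
`Γ_K = I_𝔓₀ · U` for the prime `𝔓₀ = adicCompletionPrime K v̄` (total ramification of `v̄` in `F`), and a sign `ε : Γ_K →* ℤˣ` with open kernel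
which is `1` on `U ∩ D_v̄`. Then there is a sign `χ : Γ_K →* ℤˣ`, trivial on `U`, with `ker χ` and `ker (εχ)` open and `εχ = 1` on `D_v̄`
(`I_𝔓₀ ≤ D_v̄`, so `Γ_K = D_v̄ · U`; `exists_signHom_eq_on_of_mul_eq_top`). [folklore] [cite: GreenbergLNM1716, §4 p. 107] -/
theorem exists_signHom_retwist (F : IntermediateField K (AlgebraicClosure K)) [(galFixing K F).Normal]
    (hU : IsOpen (galFixing K F : Set (absoluteGaloisGroup K))) (ε : absoluteGaloisGroup K →* ℤˣ)
    (hε : IsOpen ((ε.ker : Subgroup (absoluteGaloisGroup K)) : Set (absoluteGaloisGroup K))) (vbar : HeightOneSpectrum (𝓞 K))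
    (htot : ∀ σ : absoluteGaloisGroup K,
      ∃ τ ∈ (adicCompletionPrime K vbar).inertia (absoluteGaloisGroup K), τ⁻¹ * σ ∈ galFixing K F)
    (hεDU : ∀ u ∈ galFixing K F, u ∈ GreenbergSelmer.decomp vbar → ε u = 1) :
    ∃ χ : absoluteGaloisGroup K →* ℤˣ, (∀ u ∈ galFixing K F, χ u = 1) ∧
      IsOpen ((χ.ker : Subgroup (absoluteGaloisGroup K)) : Set (absoluteGaloisGroup K)) ∧
      IsOpen (((ε * χ).ker : Subgroup (absoluteGaloisGroup K)) : Set (absoluteGaloisGroup K)) ∧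
      ∀ σ ∈ GreenbergSelmer.decomp vbar, (ε * χ) σ = 1 := by
  have hID : (adicCompletionPrime K vbar).inertia (absoluteGaloisGroup K) ≤ GreenbergSelmer.decomp vbar := by
    intro τ hτ
    have h1 : τ ∈ (adicCompletionPrime K vbar).decompositionSubgroup (absoluteGaloisGroup K) := Ideal.inertia_le_stabilizer _ hτ
    rw [decompositionSubgroup_adicCompletionPrime_eq_range] at h1
    exact h1
  have hDU : ∀ g : absoluteGaloisGroup K, ∃ d ∈ GreenbergSelmer.decomp vbar, d⁻¹ * g ∈ galFixing K F := fun g ↦ by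
    obtain ⟨τ, hτ, hτg⟩ := htot g
    exact ⟨τ, hID hτ, hτg⟩
  obtain ⟨χ, hχU, hχD⟩ := exists_signHom_eq_on_of_mul_eq_top (GreenbergSelmer.decomp vbar) (galFixing K F) ε hDU
    (fun u hu huD ↦ hεDU u hu huD)
  have hχopen : IsOpen ((χ.ker : Subgroup (absoluteGaloisGroup K)) : Set (absoluteGaloisGroup K)) :=
    isOpen_ker_of_le χ (galFixing K F) hU fun u hu ↦ (MonoidHom.mem_ker).2 (hχU u hu)
  refine ⟨χ, hχU, hχopen, isOpen_ker_mul ε χ hε hχopen, fun σ hσ ↦ ?_⟩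
  rw [MonoidHom.mul_apply, hχD σ hσ, Int.units_mul_self]

end Frame

end Summit.BirchSwinnertonDyer.BirchSwinnertonDyer.Theorems.PrintCf2.SignTwist
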